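import Summits.Schanuel.Schanuel.Theorems.DiophantineDichotomyKhovanskiiApproxTypeEvRareFieldLWPointFree
import Summits.Schanuel.Schanuel.Theorems.DiophantineDichotomyKhovanskiiApproxTypeEvIffStubs
import Summits.Schanuel.Schanuel.Theorems.KhovanskiiApproxTypeEv.Negative.ConjugateFloor
import HarnessLib

/-!
# Line `rare-field-species` — THE CRUX HAS THREE OPEN LAYERS (`khovanskiiApproxTypeEv_iff_threeLayers`)
# — crux `KhovanskiiApproxTypeEv` (stmt-Schanuel-14972)

Route `DiophantineDichotomy` (sub-problem `Schanuel/Schanuel`), line lead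
`prover-line-stmt-Schanuel-14972-a4-0`; §2′ of the support skeleton
`Cruxes/KhovanskiiApproxTypeEv/Lines/rare_field_species.lean` with its stub DISCHARGED:
`stub_lwPointFree : LWPointFree` (algebraic points are free Khovanskii points,
`…RareFieldLWPointFree.lean`, p136499); vocabulary `…RareFieldDefs.lean` (p136201).

* `khovanskiiApproxTypeEv_iff_threeLayers : KhovanskiiApproxTypeEv ↔ (EvNonLWTwo ∧ (∀ n, 3 ≤ n → EvLW n)
  ∧ EvNonLWRankThreeUp)` (registered goal, UNCONDITIONAL) — given the landed `EvLWTwo` (p123471) and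
  `khovanskiiApproxTypeEv_iff_stubs : KhovanskiiApproxTypeEv ↔ EvNonLWTwo ∧ EvRankThreeUp` (p125111), the
  crux as filed is the conjunction of THREE open statements: `EvNonLWTwo` (⊇ `e ⊥ π`, p124086), the
  NAIVE-currency Lindemann–Weierstrass layer `∀ n ≥ 3, EvLW n` (the card `rare-field-species`:
  method-class-capped at `(n+1)/(2n) > 1/(n−1)` for every `(degree, absolute height)`-priced input —
  certificate game `…RareFieldCertificateGame.lean`, p136514 — open for a purely Diophantine reason,
  while its `(d,h)`-currency form `EvLWDh` is a theorem at every rank, `…RareFieldLWDh.lean`), and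
  `EvNonLWRankThreeUp` (⊇ two algebraically independent logarithms, p124970).
* `evRankThreeUp_iff_layers : EvRankThreeUp ↔ (∀ n ≥ 3, EvLW n) ∧ EvNonLWRankThreeUp` (honest case split
  `s ∈ ℚ̄ⁿ` or not), `evLW_of_ev` (the crux restricts to its naive LW layer at every rank `n ≥ 2`).
* `evLW_two : EvLW 2` (the landed layer `EvLWTwo`, `a = 3/4`) and `evLW_two_window` (consistency with
  the disprover's floor `a ≥ 1/2` at `(1+i, 1−i)`, `Negative/ConjugateFloor.lean`, p100002).

Nothing here closes or refutes stmt-Schanuel-14972 (support skeleton by design).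
-/

noncomputable section

-- `Summit.Schanuel.Schanuel.…` is the mandated summit/sub-problem namespace (single-conjunct summit), hence:
set_option linter.dupNamespace false

namespace Summit.Schanuel.Schanuel.Cruxes.KhovanskiiApproxTypeEv.RareFieldSpecies

open Summit.Schanuel.Schanuel.Theses.DiophantineDichotomy (KhovanskiiApproxTypeEv)
open Summit.Schanuel.Schanuel.Cruxes.KhovanskiiApproxTypeEv.AnchoredReduction
  (ApproxTypeEvAt EvLWTwo EvNonLWTwo EvRankThreeUp khovanskiiApproxTypeEv_iff
    khovanskiiApproxTypeEv_iff_stubs stub_evLW_two)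
open Summit.Schanuel.Schanuel.Cruxes.KhovanskiiApproxTypeEv.Negative (evLWTwo_window)

/-! ## The layers of `EvRankThreeUp` and of the crux -/

/-- The crux restricts to its naive LW layer at every rank `n ≥ 2`. -/
theorem evLW_of_ev (hF : LWPointFree) (hEv : KhovanskiiApproxTypeEv) (n : ℕ) (hn : 2 ≤ n) :
    EvLW n :=
  fun s halg hli => (khovanskiiApproxTypeEv_iff.1 hEv) n s hn hli (hF n s halg)

/-- `EvRankThreeUp` restricts to the naive LW layer at every rank `n ≥ 3`. -/
theorem evLW_of_evRankThreeUp (hF : LWPointFree) (hR : EvRankThreeUp) (n : ℕ) (hn : 3 ≤ n) :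
    EvLW n :=
  fun s halg hli => hR n s hn hli (hF n s halg)

/-- `EvRankThreeUp` restricts to its non-LW part. -/
theorem evNonLWRankThreeUp_of_evRankThreeUp (hR : EvRankThreeUp) : EvNonLWRankThreeUp :=
  fun n s hn hli hfree _ => hR n s hn hli hfree

/-- The two rank-`≥ 3` layers give `EvRankThreeUp` back (honest case split `s ∈ ℚ̄ⁿ` or not). -/
theorem evRankThreeUp_of_layers (hL : ∀ n, 3 ≤ n → EvLW n) (hN : EvNonLWRankThreeUp) :
    EvRankThreeUp := by
  intro n s hn hli hfree
  by_cases halg : ∀ i, IsAlgebraic ℚ (s i)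
  · exact hL n hn s halg hli
  · push Not at halg
    exact hN n s hn hli hfree halg

/-- `EvRankThreeUp ↔ (∀ n ≥ 3, EvLW n) ∧ EvNonLWRankThreeUp`, modulo `LWPointFree`. -/
theorem evRankThreeUp_iff_layers (hF : LWPointFree) :
    EvRankThreeUp ↔ (∀ n, 3 ≤ n → EvLW n) ∧ EvNonLWRankThreeUp :=
  ⟨fun hR => ⟨evLW_of_evRankThreeUp hF hR, evNonLWRankThreeUp_of_evRankThreeUp hR⟩,
    fun h => evRankThreeUp_of_layers h.1 h.2⟩

/-- **THREE LAYERS.**  Given the landed `EvLWTwo` (p123471), the crux as filed is equivalent to the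
conjunction of THREE open statements: `EvNonLWTwo` (⊇ `e ⊥ π`, p124086), the naive LW layer
`∀ n ≥ 3, EvLW n` (this card: RFT-class open, §4–§5), and `EvNonLWRankThreeUp` (⊇ two algebraically
independent logarithms, p124970) — modulo the stub `LWPointFree`. -/
theorem khovanskiiApproxTypeEv_iff_threeLayers_of (hF : LWPointFree) :
    KhovanskiiApproxTypeEv ↔ EvNonLWTwo ∧ (∀ n, 3 ≤ n → EvLW n) ∧ EvNonLWRankThreeUp := by
  rw [khovanskiiApproxTypeEv_iff_stubs, evRankThreeUp_iff_layers hF]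


/-- **THREE LAYERS, UNCONDITIONAL** (registered goal of line `rare-field-species`): the crux as filed
is equivalent to `EvNonLWTwo ∧ (∀ n ≥ 3, EvLW n) ∧ EvNonLWRankThreeUp` — `LWPointFree` discharged by
`stub_lwPointFree` (p136499). -/
theorem khovanskiiApproxTypeEv_iff_threeLayers :
    KhovanskiiApproxTypeEv ↔ (EvNonLWTwo ∧ (∀ n, 3 ≤ n → EvLW n) ∧ EvNonLWRankThreeUp) :=
  khovanskiiApproxTypeEv_iff_threeLayers_of stub_lwPointFree

/-- The crux restricts to its naive LW layer at every rank `n ≥ 2`, unconditionally. -/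
theorem evLW_of_ev' (hEv : KhovanskiiApproxTypeEv) (n : ℕ) (hn : 2 ≤ n) : EvLW n :=
  evLW_of_ev stub_lwPointFree hEv n hn

/-- `EvRankThreeUp ↔ (∀ n ≥ 3, EvLW n) ∧ EvNonLWRankThreeUp`, unconditionally. -/
theorem evRankThreeUp_iff_layers' : EvRankThreeUp ↔ (∀ n, 3 ≤ n → EvLW n) ∧ EvNonLWRankThreeUp :=
  evRankThreeUp_iff_layers stub_lwPointFree

/-! ## The rank-2 naive LW layer is a theorem -/

/-- `EvLW 2` is literally the landed layer `EvLWTwo` (`1/(2−1) = 1`). -/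
theorem evLW_two_iff : EvLW 2 ↔ EvLWTwo := by
  have h1 : (1 : ℝ) / (((2 : ℕ) : ℝ) - 1) = 1 := by norm_num
  constructor
  · intro h s halg hli
    obtain ⟨a, b, C, ha, hat⟩ := h s halg hli
    exact ⟨a, b, C, by rwa [h1] at ha, hat⟩
  · intro h s halg hli
    obtain ⟨a, b, C, ha, hat⟩ := h s halg hli
    exact ⟨a, b, C, by rwa [h1], hat⟩

/-- The naive LW layer at rank `2` is a THEOREM (Ably 1994 through the landed transfer spine,
`stub_evLW_two`, p123471; value `a = 3/4` = the game value `(n+1)/(2n)` at `n = 2`). -/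
theorem evLW_two : EvLW 2 :=
  evLW_two_iff.2 stub_evLW_two

/-- Consistency with the disprover's floor (`Negative/ConjugateFloor.lean`, p100002): at the LW point
`(1+i, 1−i)` the naive layer lives in the window `[1/2, 1)` — the conjugate pair is the `p = 2`
dihedral shadow of the card's abelian-square species. -/
theorem evLW_two_window :
    ∃ a b C : ℝ, 1 / 2 ≤ a ∧ a < 1 ∧ ApproxTypeEvAt 2 ![(1 : ℂ) + Complex.I, 1 - Complex.I] a b C :=
  evLWTwo_window (evLW_two_iff.1 evLW_two)

end Summit.Schanuel.Schanuel.Cruxes.KhovanskiiApproxTypeEv.RareFieldSpecies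

end
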